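import Mathlib
import Literature.Computability.AlgebraicComplexity.AlperBogartVelascoProofs
import Literature.Computability.AlgebraicComplexity.LandsbergRessayreNormalForm
import Literature.Computability.AlgebraicComplexity.StandardFamiliesProofs
import Summits.ValiantsHypothesis.ValiantsHypothesis.Theorems.BorderApolarityToricWitnessObstructionQPNoSevenPlane
import Summits.ValiantsHypothesis.ValiantsHypothesis.Theorems.BorderApolarityToricWitnessObstructionQPInitialDegeneration
import Summits.ValiantsHypothesis.ValiantsHypothesis.Theorems.BorderApolarityToricWitnessObstructionQPPrincipalMinors
import Summits.ValiantsHypothesis.ValiantsHypothesis.Theorems.BorderApolarityToricWitnessObstructionQPLowOrderSubspace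
import Summits.ValiantsHypothesis.ValiantsHypothesis.Theorems.BorderApolarityToricWitnessObstructionQPComponentCalculus
import Summits.ValiantsHypothesis.ValiantsHypothesis.Theorems.BorderApolarityToricWitnessObstructionQPSingularBlock
import Summits.ValiantsHypothesis.ValiantsHypothesis.Theorems.BorderApolarityToricWitnessObstructionQPBorder33
import Summits.ValiantsHypothesis.ValiantsHypothesis.Theorems.BorderApolarityToricWitnessObstructionQPJetRegimePrep

/-!
# The jet regime of torus leading forms of `per₃` is empty below size `7`

Route `ValiantsHypothesis/BorderApolarity`, crux `ToricWitnessObstructionQP`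
(stmt-ValiantsHypothesis-14753), line `Sketch`, lead c5 — the JET-REGIME THEOREM of the regime
analysis of the smallest open instances `(3,5)`, `(3,6)` of the registered stub
`stub_equivariantCore` (crux work note `regimes.md`, §3).

A toric H₀-stable witness for the padded permanent at `(3, m)` yields (landed normal-form chain
of line `Sketch`) a torus leading form: an affine `m × m` pencil `A₀ + B(y)` and a weight `w` with
`in_w det(A₀ + B(y)) = per₃` (chart form, signed Kőnig weights).  In every weight class in which all
monomials of degree `≤ 2` are heavier than the permutation monomials — the x₀₀-DOMINANT cone, where
all the computed witnesses live (lead c4: `(2,3..6)`, `(3,7)`) — this says that `P := det(A₀ + B(y))`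
has `P₀ = P₁ = P₂ = 0` and that `per₃` is the top `w`-weight part of its cubic part `P₃`.

* `seven_le_of_jetRegime`: for ANY square matrix `A` of affine polynomials in the nine variables
  with `(det A)₀ = (det A)₁ = (det A)₂ = 0` and `in_w (det A)₃ = per₃` for some weight `w`, the size
  is `≥ 7` (Grenet's size; sharp).  This strengthens Alper–Bogart–Velasco's `dc(per₃) = 7`
  (the case `w = 0`, no garbage) to garbage-perturbed cubic parts, i.e. to all x₀₀-dominant toric
  degenerations.

Proof (all ingredients kernel-checked in the sibling helper files): bring the constant part to a
`0/1` diagonal `D` (`Matrix.exists_rank_normal_form`); by the principal-minor expansion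
(`PrincipalMinors`) the corank `r = |S₀|` satisfies: `r ≥ 4` ⟹ `P₃ = 0`; `r = 3` ⟹ `P₃` is a `3 × 3`
linear determinant, excluded by border `(3,3)` + LMR (`Border33`); `r = 2` ⟹ the `2 × 2` block is a
singular matrix of linear forms, so (`SingularBlock`) all `3 × 3` principal minors through it vanish
on a subspace of codimension `≤ 2`, hence (`InitialDegeneration`) `per₃` vanishes on a `7`-plane,
excluded by `NoSevenPlane`; `r = 1` ⟹ ABV's subspace (`LowOrderSubspace`) of dimension `≥ 10 - m`
on which all `∂P` vanish, hence (`ComponentCalculus`, `InitialDegeneration`) all `∂ per₃` vanish on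
a subspace of dimension `≥ 10 - m ≥ 4`, excluded by the Box lemma; `r = 0` ⟹ `P₀ ≠ 0`.
-/

open MvPolynomial Module Matrix Finset

-- the mandated summit-side namespace repeats a component by design (single-problem summit)
set_option linter.dupNamespace false

namespace Summit.ValiantsHypothesis.ValiantsHypothesis.Theorems.BorderApolarityToricWitnessObstructionQP

noncomputable section

namespace JetRegime

open Literature.Computability.AlgebraicComplexity
open Literature.Computability.AlgebraicComplexity.AlperBogartVelasco LRPencil

/-- **The jet regime is empty below `7`.**  If `A` is an `m × m` matrix of affine polynomials in the
nine variables `y_ij` whose determinant `P` has vanishing constant, linear and quadratic parts, and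
whose cubic part `P₃` has `per₃` as its top `w`-weight component for some weight `w`, then `7 ≤ m`.
(`w = 0`: Alper–Bogart–Velasco's `dc(per₃) ≥ 7`; general `w`: no x₀₀-dominant torus leading form of
`per₃` has size `≤ 6`, regimes.md §3.) [cite: AlperBogartVelasco2017, Theorem 1.2] -/
theorem seven_le_of_jetRegime {m : ℕ} (A : Matrix (Fin m) (Fin m) (MvPolynomial (Fin 3 × Fin 3) ℂ))
    (hA : ∀ i j, (A i j).totalDegree ≤ 1)
    (h0 : homogeneousComponent 0 A.det = 0) (h1 : homogeneousComponent 1 A.det = 0)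
    (h2 : homogeneousComponent 2 A.det = 0)
    (w : Fin 3 × Fin 3 → ℕ) (e : ℕ)
    (hwe : ∀ d ∈ (homogeneousComponent 3 A.det).support, Finsupp.weight w d ≤ e)
    (htop : weightedHomogeneousComponent w e (homogeneousComponent 3 A.det) = perPoly (Fin 3) ℂ) :
    7 ≤ m := by
  classical
  by_contra hm
  push Not at hm
  set P : MvPolynomial (Fin 3 × Fin 3) ℂ := A.det with hPdef
  set P₃ : MvPolynomial (Fin 3 × Fin 3) ℂ := homogeneousComponent 3 P with hP₃def
  have hP₃ne : P₃ ≠ 0 := by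
    intro h
    rw [h, map_zero] at htop
    exact perPoly_ne_zero (Fin 3) ℂ htop.symm
  have hP₃hom : P₃.IsHomogeneous 3 := homogeneousComponent_isHomogeneous 3 P
  ------------------------------------------------------------------ rank normal form
  obtain ⟨V, U, eqv, hV, hU, hVU⟩ := Matrix.exists_rank_normal_form (constPart A)
  set S₀ : Finset (Fin m) := Finset.univ.filter fun i => (eqv i).isRight = true with hS₀
  set d : Fin m → ℂ := fun i => if i ∈ S₀ then 0 else 1 with hd
  have hVU' : V * constPart A * U = Matrix.diagonal d := by
    rw [hVU, rankNormalForm_eq_diagonal]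
  set B : Matrix (Fin m) (Fin m) (MvPolynomial (Fin 3 × Fin 3) ℂ) := V.map C * A * U.map C with hB
  have hB0 : constPart B = Matrix.diagonal d := by
    rw [hB, constPart_mul, constPart_mul, constPart_map_C, constPart_map_C, hVU']
  have hB1 : ∀ r j, (B r j).totalDegree ≤ 1 := by
    intro r j
    rw [hB, Matrix.mul_apply]
    refine totalDegree_finsetSum_le fun l _ => ?_
    rw [Matrix.mul_apply, Matrix.map_apply]
    refine (totalDegree_mul _ _).trans ?_
    rw [totalDegree_C, add_zero]
    refine totalDegree_finsetSum_le fun k _ => ?_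
    rw [Matrix.map_apply]
    refine (totalDegree_mul _ _).trans ?_
    rw [totalDegree_C, zero_add]
    exact hA k l
  set c : ℂ := V.det * U.det with hc
  have hc0 : c ≠ 0 :=
    mul_ne_zero ((Matrix.isUnit_iff_isUnit_det V).1 hV).ne_zero
      ((Matrix.isUnit_iff_isUnit_det U).1 hU).ne_zero
  have hdetB : B.det = C c * P := by
    have hVd : (V.map (C : ℂ →+* MvPolynomial (Fin 3 × Fin 3) ℂ)).det = C V.det := by
      rw [← RingHom.mapMatrix_apply, ← RingHom.map_det]
    have hUd : (U.map (C : ℂ →+* MvPolynomial (Fin 3 × Fin 3) ℂ)).det = C U.det := by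
      rw [← RingHom.mapMatrix_apply, ← RingHom.map_det]
    rw [hB, Matrix.det_mul, Matrix.det_mul, hVd, hUd, hc, map_mul, hPdef]
    ring
  -- the linear part `Z` and `B = D + Z`
  set Z : Matrix (Fin m) (Fin m) (MvPolynomial (Fin 3 × Fin 3) ℂ) :=
    B - (Matrix.diagonal d).map C with hZ
  have hZhom : ∀ i j, (Z i j).IsHomogeneous 1 := by
    intro i j
    have hBij : B i j - C (constantCoeff (B i j)) = Z i j := by
      rw [hZ, Matrix.sub_apply, Matrix.map_apply, ← hB0, constPart_apply]
    rw [← hBij]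
    refine isHomogeneous_one_of_totalDegree_le_one ?_ ?_
    · refine (totalDegree_sub _ _).trans (max_le (hB1 i j) ?_)
      rw [totalDegree_C]; exact Nat.zero_le _
    · rw [coeff_sub, coeff_C, if_pos rfl, ← constantCoeff_eq, sub_self]
  have hDmap : (Matrix.diagonal d).map (C : ℂ →+* MvPolynomial (Fin 3 × Fin 3) ℂ) =
      Matrix.diagonal fun i => if i ∈ S₀ then (0 : MvPolynomial (Fin 3 × Fin 3) ℂ) else 1 := by
    rw [Matrix.diagonal_map (map_zero C)]
    congr 1
    funext i
    simp only [hd]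
    split_ifs <;> simp
  have hBDZ : B = (Matrix.diagonal fun i => if i ∈ S₀ then (0 : MvPolynomial (Fin 3 × Fin 3) ℂ) else 1) + Z := by
    rw [← hDmap, hZ]; abel
  -- homogeneous components of `det B = c · P`
  have hcomp : ∀ k, homogeneousComponent k B.det = C c * homogeneousComponent k P := by
    intro k; rw [hdetB, homogeneousComponent_C_mul]
  have hexp : ∀ k, C c * homogeneousComponent k P =
      ∑ T ∈ (Finset.univ : Finset (Fin m)).powerset with (S₀ ⊆ T ∧ T.card = k),
        (Z.submatrix (fun a : T => (a : Fin m)) (fun a : T => (a : Fin m))).det := by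
    intro k
    rw [← hcomp, hBDZ, PrincipalMinors.homogeneousComponent_det_diagonal_add S₀ Z hZhom k]
  ------------------------------------------------------------------ case analysis on `|S₀|`
  have hP0 : homogeneousComponent 0 P = 0 := h0
  have hP1 : homogeneousComponent 1 P = 0 := h1
  have hP2 : homogeneousComponent 2 P = 0 := h2
  rcases Nat.lt_or_ge S₀.card 4 with hlt | hge
  swap
  · ---------------------------------------------------------------- `r ≥ 4`: `P₃ = 0`
    have h := PrincipalMinors.homogeneousComponent_det_eq_zero_of_lt S₀ Z hZhom
      (show 3 < S₀.card by omega)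
    rw [← hBDZ, hcomp] at h
    exact hP₃ne ((mul_eq_zero.1 h).resolve_left (by intro h'; exact hc0 (by simpa using h')))
  interval_cases hcard : S₀.card
  · ---------------------------------------------------------------- `r = 0`: `P₀ ≠ 0`
    have h := hexp 0
    rw [hP0, mul_zero] at h
    have hfil : ((Finset.univ : Finset (Fin m)).powerset.filter fun T => S₀ ⊆ T ∧ T.card = 0) =
        {∅} := by
      ext T
      simp only [Finset.mem_filter, Finset.mem_powerset, Finset.subset_univ, true_and,
        Finset.mem_singleton, Finset.card_eq_zero]
      constructor
      · exact fun h => h.2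
      · rintro rfl
        exact ⟨by rw [Finset.card_eq_zero.1 hcard], rfl⟩
    rw [hfil, Finset.sum_singleton, Matrix.det_isEmpty] at h
    exact one_ne_zero h.symm
  · ---------------------------------------------------------------- `r = 1`: ABV + Box lemma
    obtain ⟨i₀, hi₀⟩ := Finset.card_eq_one.1 hcard
    have hm0 : 0 < m := Fin.pos i₀
    have hlam : Matrix.diagonal d = lamMatrix ℂ i₀ := by
      ext i j
      rw [Matrix.diagonal_apply, lamMatrix_apply, hd]
      simp only [hi₀, Finset.mem_singleton]
    have hrank : (constPart B).rank = m - 1 := by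
      rw [hB0, hlam, rank_lamMatrix, Fintype.card_fin]
    have hcc1 : ∀ a, constantCoeff (pderiv a B.det) = 0 := fun a =>
      ComponentCalculus.constantCoeff_pderiv_eq_zero_of_component_one a _ (by rw [hcomp, hP1, mul_zero])
    have hcc2 : ∀ a b, constantCoeff (pderiv b (pderiv a B.det)) = 0 := fun a b =>
      ComponentCalculus.constantCoeff_pderiv_pderiv_eq_zero_of_component_two a b _
        (by rw [hcomp, hP2, mul_zero])
    obtain ⟨W, hWdim, hWvan⟩ :=
      LowOrderSubspace.exists_subspace_of_det_lowOrder hm0 hB1 hrank hcc1 hcc2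
    rw [Fintype.card_prod, Fintype.card_fin] at hWdim
    -- all `∂_a P` vanish on `W`, hence all `∂_a P₃`
    have hvanP : ∀ a, ∀ x ∈ W, MvPolynomial.eval x (pderiv a P) = 0 := by
      intro a x hx
      have h := hWvan x hx a
      rw [hdetB, pderiv_C_mul, map_mul, eval_C] at h
      exact (mul_eq_zero.1 h).resolve_left hc0
    have hvanP₃ : ∀ a, ∀ x ∈ W, MvPolynomial.eval x (pderiv a P₃) = 0 := by
      intro a x hx
      have h := ComponentCalculus.eval_homogeneousComponent_eq_zero_of_subspace W _ (hvanP a) 2 x hx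
      rwa [ComponentCalculus.homogeneousComponent_pderiv] at h
    -- degenerate along the torus: all `∂_a per₃` vanish on `W'`
    obtain ⟨W', hW'dim, hW'⟩ := InitialDegeneration.exists_initialSubspace w W
    have hvanPer : ∀ a, ∀ y ∈ W', MvPolynomial.eval y (pderiv a (perPoly (Fin 3) ℂ)) = 0 := by
      intro a y hy
      have hwa : w a ≤ e := weight_le_of_top_eq_perPoly w e P₃ htop a
      have hbound : ∀ d' ∈ (pderiv a P₃).support, Finsupp.weight w d' ≤ e - w a := by
        intro d' hd'
        rw [MvPolynomial.mem_support_iff, coeff_pderiv] at hd'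
        have h' : coeff (d' + Finsupp.single a 1) P₃ ≠ 0 := fun h => hd' (by rw [h, zero_mul])
        have := hwe _ (MvPolynomial.mem_support_iff.2 h')
        rw [map_add, ComponentCalculus.weight_single_one] at this
        omega
      have h := hW' (pderiv a P₃) 2 (e - w a) (by simpa using hP₃hom.pderiv (i := a)) hbound
        (hvanP₃ a) y hy
      rwa [ComponentCalculus.weightedHomogeneousComponent_pderiv, Nat.sub_add_cancel hwa, htop] at h
    have hbox := finrank_le_three_of_subperm_two_vanish W' fun y hy r c' => by
      rw [← eval_pderiv_perPoly_eq_permanent_submatrix]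
      exact hvanPer (r, c') y hy
    omega
  · ---------------------------------------------------------------- `r = 2`: singular block + 7-plane
    obtain ⟨s₁, s₂, h12, hS₀eq⟩ := Finset.card_eq_two.1 hcard
    -- the `2 × 2` block of `Z` on `S₀`, reindexed by `Fin 2`
    let v2 : Fin 2 → Fin m := ![s₁, s₂]
    let N : Matrix (Fin 2) (Fin 2) (MvPolynomial (Fin 3 × Fin 3) ℂ) := Z.submatrix v2 v2
    have hNhom : ∀ i j, (N i j).IsHomogeneous 1 := fun i j => hZhom _ _
    have hNdet : N.det = 0 := by
      -- `det N = det Z[S₀,S₀] = c · P₂ = 0`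
      have h := hexp 2
      rw [hP2, mul_zero] at h
      have hfil : ((Finset.univ : Finset (Fin m)).powerset.filter fun T => S₀ ⊆ T ∧ T.card = 2) =
          {S₀} := by
        ext T
        simp only [Finset.mem_filter, Finset.mem_powerset, Finset.subset_univ, true_and,
          Finset.mem_singleton]
        constructor
        · rintro ⟨hsub, hT⟩
          exact (Finset.eq_of_subset_of_card_le hsub (by rw [hT, hcard])).symm
        · rintro rfl; exact ⟨le_rfl, hcard⟩
      rw [hfil, Finset.sum_singleton] at h
      -- reindex `S₀ ≃ Fin 2`
      have hv : ∀ t, v2 t ∈ S₀ := by intro t; rw [hS₀eq]; fin_cases t <;> simp [v2]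
      let g : Fin 2 → ↥S₀ := fun t => ⟨v2 t, hv t⟩
      have hinj2 : Function.Injective v2 := by
        intro a b hab
        fin_cases a <;> fin_cases b
        · rfl
        · simp [v2] at hab; exact absurd hab h12
        · simp [v2] at hab; exact absurd hab.symm h12
        · rfl
      have hg : Function.Bijective g := by
        refine (Fintype.bijective_iff_injective_and_card g).2 ⟨fun a b hab => ?_, ?_⟩
        · exact hinj2 (congr_arg Subtype.val hab)
        · rw [Fintype.card_coe, hcard, Fintype.card_fin]
      let eqv2 : Fin 2 ≃ ↥S₀ := Equiv.ofBijective g hg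
      have hN : N = (Z.submatrix (fun a : S₀ => (a : Fin m)) (fun a : S₀ => (a : Fin m))).submatrix
          eqv2 eqv2 := by
        ext i j; rfl
      rw [hN, Matrix.det_submatrix_equiv_self]
      exact h.symm
    obtain ⟨e₁, e₂, hctrl⟩ := SingularBlock.exists_two_entries_control N hNhom hNdet
    obtain ⟨L₁, hL₁⟩ := exists_linearMap_eval (hNhom e₁.1 e₁.2)
    obtain ⟨L₂, hL₂⟩ := exists_linearMap_eval (hNhom e₂.1 e₂.2)
    set W : Submodule ℂ (Fin 3 × Fin 3 → ℂ) := LinearMap.ker L₁ ⊓ LinearMap.ker L₂ with hWdef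
    -- `P₃` vanishes on `W`
    have hvan : ∀ x ∈ W, MvPolynomial.eval x P₃ = 0 := by
      intro x hx
      obtain ⟨hx1, hx2⟩ := Submodule.mem_inf.1 hx
      rw [LinearMap.mem_ker, hL₁] at hx1
      rw [LinearMap.mem_ker, hL₂] at hx2
      have hall := hctrl x hx1 hx2
      -- every entry of `Z[S₀,S₀]` vanishes at `x`
      have hzero : ∀ a ∈ ({s₁, s₂} : Finset (Fin m)), ∀ b ∈ ({s₁, s₂} : Finset (Fin m)),
          (Z.map (MvPolynomial.eval x)) a b = 0 := by
        intro a ha b hb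
        simp only [Finset.mem_insert, Finset.mem_singleton] at ha hb
        rw [Matrix.map_apply]
        rcases ha with rfl | rfl <;> rcases hb with rfl | rfl
        · exact hall 0 0
        · exact hall 0 1
        · exact hall 1 0
        · exact hall 1 1
      have h := congr_arg (MvPolynomial.eval x) (hexp 3)
      rw [map_mul, eval_C, map_sum] at h
      have hsum : ∑ T ∈ (Finset.univ : Finset (Fin m)).powerset with (S₀ ⊆ T ∧ T.card = 3),
          MvPolynomial.eval x (Z.submatrix (fun a : T => (a : Fin m)) (fun a : T => (a : Fin m))).det = 0 := by
        refine Finset.sum_eq_zero fun T hT => ?_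
        rw [Finset.mem_filter] at hT
        obtain ⟨-, hsub, hT3⟩ := hT
        rw [RingHom.map_det, RingHom.mapMatrix_apply, ← Matrix.submatrix_map]
        -- `T = {s₁, s₂, i}`
        have hdiff : (T \ S₀).card = 1 := by
          rw [Finset.card_sdiff_of_subset hsub, hT3, hcard]
        obtain ⟨i, hi⟩ := Finset.card_eq_one.1 hdiff
        have hiT : i ∈ T ∧ i ∉ S₀ := by
          have : i ∈ T \ S₀ := by rw [hi]; exact Finset.mem_singleton_self i
          exact Finset.mem_sdiff.1 this
        have hTeq : T = {s₁, s₂, i} := by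
          have : T = S₀ ∪ (T \ S₀) := (Finset.union_sdiff_of_subset hsub).symm
          rw [this, hi, hS₀eq]
          ext y; simp
        have h1i : s₁ ≠ i := fun h => hiT.2 (by rw [hS₀eq, ← h]; simp)
        have h2i : s₂ ≠ i := fun h => hiT.2 (by rw [hS₀eq, ← h]; simp)
        exact det_submatrix_eq_zero_of_block (Z.map (MvPolynomial.eval x)) h12 h1i h2i hzero T hTeq
      rw [hsum] at h
      exact (mul_eq_zero.1 h).resolve_left hc0
    -- `dim W ≥ 7`
    have hWdim : 7 ≤ finrank ℂ W := by
      have hk : ∀ L : (Fin 3 × Fin 3 → ℂ) →ₗ[ℂ] ℂ, 8 ≤ finrank ℂ (LinearMap.ker L) := by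
        intro L
        have h1 := LinearMap.finrank_range_add_finrank_ker L
        have h2 : finrank ℂ (LinearMap.range L) ≤ 1 := by
          calc finrank ℂ (LinearMap.range L) ≤ finrank ℂ ℂ := Submodule.finrank_le _
            _ = 1 := finrank_self ℂ
        rw [finrank_fintype_fun_eq_card, Fintype.card_prod, Fintype.card_fin] at h1
        omega
      have hsup : finrank ℂ ↥(LinearMap.ker L₁ ⊔ LinearMap.ker L₂) ≤ 9 := by
        calc finrank ℂ ↥(LinearMap.ker L₁ ⊔ LinearMap.ker L₂) ≤ finrank ℂ (Fin 3 × Fin 3 → ℂ) :=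
              Submodule.finrank_le _
          _ = 9 := by rw [finrank_fintype_fun_eq_card, Fintype.card_prod, Fintype.card_fin]
      have hdim := Submodule.finrank_sup_add_finrank_inf_eq (LinearMap.ker L₁) (LinearMap.ker L₂)
      have hk1 := hk L₁
      have hk2 := hk L₂
      rw [← hWdef] at hdim
      omega
    -- degenerate: `per₃` vanishes on `W'`, `dim W' ≥ 7`
    obtain ⟨W', hW'dim, hW'⟩ := InitialDegeneration.exists_initialSubspace w W
    have hvanPer : ∀ y ∈ W', MvPolynomial.eval y (perPoly (Fin 3) ℂ) = 0 := by
      intro y hy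
      rw [← htop]
      exact hW' P₃ 3 e hP₃hom hwe hvan y hy
    have h6 := NoSevenPlane.finrank_le_six_of_eval_perPoly_three_eq_zero two_ne_zero W' hvanPer
    omega
  · ---------------------------------------------------------------- `r = 3`: border `(3,3)`
    have h := hexp 3
    have hfil : ((Finset.univ : Finset (Fin m)).powerset.filter fun T => S₀ ⊆ T ∧ T.card = 3) =
        {S₀} := by
      ext T
      simp only [Finset.mem_filter, Finset.mem_powerset, Finset.subset_univ, true_and,
        Finset.mem_singleton]
      constructor
      · rintro ⟨hsub, hT⟩
        exact (Finset.eq_of_subset_of_card_le hsub (by rw [hT, hcard])).symm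
      · rintro rfl; exact ⟨le_rfl, hcard⟩
    rw [hfil, Finset.sum_singleton] at h
    -- reindex `S₀ ≃ Fin 3`
    have hcardS : Fintype.card ↥S₀ = 3 := by rw [Fintype.card_coe, hcard]
    let eqv3 : Fin 3 ≃ ↥S₀ := (Fintype.equivFinOfCardEq hcardS).symm
    let M3 : Matrix (Fin 3) (Fin 3) (MvPolynomial (Fin 3 × Fin 3) ℂ) :=
      (Z.submatrix (fun a : S₀ => (a : Fin m)) (fun a : S₀ => (a : Fin m))).submatrix eqv3 eqv3
    have hM3hom : ∀ i j, (M3 i j).IsHomogeneous 1 := fun i j => hZhom _ _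
    have hM3det : M3.det = C c * P₃ := by
      simp only [M3]
      rw [Matrix.det_submatrix_equiv_self, ← h]
    have hP₃eq : C c⁻¹ * M3.det = P₃ := by
      rw [hM3det, ← mul_assoc, ← map_mul, inv_mul_cancel₀ hc0, C_1, one_mul]
    exact Border33.not_perPoly_three_eq_top_of_det_three M3 hM3hom c⁻¹ w e
      (by rw [hP₃eq]; exact hwe) (by rw [hP₃eq]; exact htop)

end JetRegime

/-- **The jet regime of torus leading forms of `per₃` is empty below size `7`** (registered
helper form of `JetRegime.seven_le_of_jetRegime`): an affine `m × m` matrix over the nine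
variables whose determinant has vanishing parts of degree `0, 1, 2` and whose cubic part has
`per₃` as top `w`-weight component has `m ≥ 7`. [cite: AlperBogartVelasco2017, Theorem 1.2] -/
theorem jetRegime_seven_le : ∀ {m : ℕ} (A : Matrix (Fin m) (Fin m) (MvPolynomial (Fin 3 × Fin 3) ℂ)), (∀ i j, (A i j).totalDegree ≤ 1) → MvPolynomial.homogeneousComponent 0 A.det = 0 → MvPolynomial.homogeneousComponent 1 A.det = 0 → MvPolynomial.homogeneousComponent 2 A.det = 0 → ∀ (w : Fin 3 × Fin 3 → ℕ) (e : ℕ), (∀ d ∈ (MvPolynomial.homogeneousComponent 3 A.det).support, Finsupp.weight w d ≤ e) → MvPolynomial.weightedHomogeneousComponent w e (MvPolynomial.homogeneousComponent 3 A.det) = Literature.Computability.AlgebraicComplexity.perPoly (Fin 3) ℂ → 7 ≤ m :=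
  fun A hA h0 h1 h2 w e hwe htop => JetRegime.seven_le_of_jetRegime A hA h0 h1 h2 w e hwe htop

end

end Summit.ValiantsHypothesis.ValiantsHypothesis.Theorems.BorderApolarityToricWitnessObstructionQP
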